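import Literature.NumberTheory.GaloisRepresentations.GaloisRep
import HarnessLib

/-!
# Tate's lifting theorem through `GSpin₆ → SO₆`: spin lifts of six-dimensional orthogonal
`ℓ`-adic Galois representations (Patrikis 2019, §2.1; Conrad)

Topic `Literature/NumberTheory/GaloisRepresentations`; ONE named fact (result in print,
`def … : Prop`, D-0014) requested by the route `Summit.Langlands.Langlands.Theses.K3KugaSatakeDescent`
(items `SpinAvatar`, `stmt-Langlands-3800`, and `EvenSectorNotPolarized`, `stmt-Langlands-3801`;
work item `wi-15742`), in the tree's language of framed Galois representations
(`FramedGaloisRep F (PadicAlgCl ℓ) n = Γ_F →ₜ* GL_n(ℚ̄_ℓ)`, `FramedRep.trace`, `FramedRep.det`,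
`FramedGaloisRep.IsUnramifiedAt`; `GaloisRep.lean`, `ContinuousRep.lean`).

## The printed results

* **Tate** (Serre, *Modular forms of weight one and Galois representations*, Thm. 4):
  `H²(Γ_F, ℚ/ℤ) = 0` for a number field `F`.
* **Lifting through central torus quotients** (S. Patrikis, *Variations on a theorem of Tate*,
  Mem. Amer. Math. Soc. 258 (2019), no. 1238 [`Patrikis2019`], Ch. 2, §2.1 "Review of lifting
  results", the Proposition attributed there to B. Conrad, *Lifting global representations with
  local properties*, Prop. 5.3; = arXiv:1207.6724, Prop. 1.0.18 of the held text): "Let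
  `H' ↠ H` be a surjection of linear algebraic groups over `ℚ̄_ℓ` with kernel a central torus.
  Then any continuous representation `ρ : Γ_F → H(ℚ̄_ℓ)` lifts to `H'(ℚ̄_ℓ)`" (proof: reduce to
  kernel `𝔾_m`, pass to the isogeny complements `H'_n ↠ H` with kernel `μ_n`, and kill the
  obstruction classes `c_n ∈ H²(Γ_F, ℤ/n)` in `lim H²(Γ_F, ℤ/n) = H²(Γ_F, ℚ/ℤ) = 0`), together
  with the Remark following it (= Conrad, loc. cit., Lemma 5.2; arXiv Remark 1.0.19, third item):
  "If `ρ` is almost everywhere unramified, then it is easy to see that `ρ̃` is almost everywhere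
  unramified."

## The instance vendored: `D₃ = A₃`

Over the algebraically closed field `k = ℚ̄_ℓ` let `V = k⁴`. The wedge pairing
`β(x, y) = x ∧ y ∈ ∧⁴V ≅ k` is a non-degenerate SYMMETRIC bilinear form on the six-dimensional
space `∧²V`, and `h ↦ ∧²h` satisfies `β(∧²h·x, ∧²h·y) = det h · β(x, y)`. Hence
`H' := {(h, t) ∈ GL(V) × 𝔾_m : det h = t²}` (a connected linear algebraic group, `≅ GSpin₆`)
maps to `SO(∧²V, β) ≅ SO₆` by `(h, t) ↦ t⁻¹ ∧²h`; this map is surjective (its restriction to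
`SL(V) = Spin₆` is the spin isogeny) with kernel `{(z, z²)} ≅ 𝔾_m`, central. Any non-degenerate
quadratic space `(k⁶, J)` is isometric to `(∧²V, β)` (`k` algebraically closed of characteristic
`0`), so a continuous `r : Γ_F → GL₆(ℚ̄_ℓ)` preserving a non-degenerate symmetric `J` with
`det r = 1` is, after conjugation by some `g ∈ GL₆(ℚ̄_ℓ)`, a continuous homomorphism
`Γ_F → SO(∧²V, β)(ℚ̄_ℓ)`; the Proposition lifts it to a continuous `(W, ν) : Γ_F → H'(ℚ̄_ℓ)`,
i.e. `W : Γ_F → GL₄(ℚ̄_ℓ)` and a continuous character `ν` with `∧²W(σ) = ν(σ) · g r(σ) g⁻¹`,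
whence the TRACE IDENTITY `ν(σ) tr r(σ) = tr ∧²W(σ) = ((tr W(σ))² − tr W(σ²)) / 2`
(`e₂` of the eigenvalues); and by the Remark `W` is unramified at all but finitely many places
when `r` is. This is the statement `Patrikis2019_exists_spinLift` below ("Tate's theorem lifts
the projective representation `Γ_F → PSO₆ = PGL₄`", in the words of the route).

## Rendering

Orthogonality and `det = 1` are written exactly as in the route's items (`∃ J`, `J.IsSymm`,
`IsUnit J`, `r(σ)ᵀ J r(σ) = J`; `FramedRep.det r σ = 1`); `∧²W ≅ ν ⊗ r` is replaced by its trace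
shadow (which is all the route consumes, and which for semisimple `r` recovers the isomorphism by
Brauer–Nesbitt). The fact is fully quantified over the number field `F` and the prime `ℓ`.
Nothing here is specific to `ℚ̄_ℓ` beyond what the source states (coefficients `ℚ̄_ℓ`, where
roots of unity of all orders are available: Patrikis, Remark after the Proposition, first item).

## What is NOT here

The general Proposition for arbitrary `H' ↠ H` (no linear algebraic groups over `ℚ̄_ℓ` in the
tree), Tate's `H²(Γ_F, ℚ/ℤ) = 0` itself, the geometric / Hodge–Tate refinements (Patrikis 2019,
Ch. 2–3: Conrad's Cor. 6.7, Wintenberger's theorem, and the geometric lifting theorem over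
totally imaginary fields), and uniqueness of `W` up to twist by characters.
-/

noncomputable section

namespace Literature.NumberTheory.GaloisRepresentations

open Field IsDedekindDomain
open scoped NumberField Matrix

/-- **Spin lifts of six-dimensional special orthogonal `ℓ`-adic Galois representations**
(Tate's lifting theorem through the central-torus quotient `GSpin₆ ↠ SO₆`, read through
`D₃ = A₃`: Patrikis 2019, Ch. 2 §2.1, the Proposition "lifting through central torus quotients"
= Conrad, Prop. 5.3, and the Remark after it = Conrad, Lemma 5.2; module docstring), NAMED FACT.
For a number field `F`, a prime `ℓ` and a continuous `r : Γ_F → GL₆(ℚ̄_ℓ)` which preserves a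
non-degenerate symmetric bilinear form `J` (`r(σ)ᵀ J r(σ) = J`), has `det r = 1`, and is
unramified at all but finitely many finite places, there are a continuous
`W : Γ_F → GL₄(ℚ̄_ℓ)` and a continuous character `ν : Γ_F → ℚ̄_ℓ^×` with `∧²W ≅ ν ⊗ r` in the
form of the trace identity `ν(σ) · tr r(σ) = ((tr W(σ))² − tr W(σ²)) / 2` for all `σ ∈ Γ_F`, and
`W` unramified at all but finitely many finite places.
[cite: Patrikis2019, Ch. 2 §2.1, Proposition (lifting through central torus quotients; = Conrad Prop. 5.3) and the following Remark] -/
def Patrikis2019_exists_spinLift : Prop :=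
  ∀ (F : Type) [Field F] [NumberField F] (ℓ : ℕ) [Fact ℓ.Prime]
    (r : FramedGaloisRep F (PadicAlgCl ℓ) 6),
    (∃ J : Matrix (Fin 6) (Fin 6) (PadicAlgCl ℓ), J.IsSymm ∧ IsUnit J ∧
      ∀ σ, ((r σ : GL (Fin 6) (PadicAlgCl ℓ)) : Matrix (Fin 6) (Fin 6) (PadicAlgCl ℓ))ᵀ * J *
        ((r σ : GL (Fin 6) (PadicAlgCl ℓ)) : Matrix (Fin 6) (Fin 6) (PadicAlgCl ℓ)) = J) →
    (∀ σ, FramedRep.det r σ = 1) →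
    (∀ᶠ v : HeightOneSpectrum (𝓞 F) in Filter.cofinite, r.IsUnramifiedAt v) →
      ∃ (W : FramedGaloisRep F (PadicAlgCl ℓ) 4) (ν : absoluteGaloisGroup F →ₜ* (PadicAlgCl ℓ)ˣ),
        (∀ σ, (ν σ : PadicAlgCl ℓ) * FramedRep.trace r σ =
            (FramedRep.trace W σ ^ 2 - FramedRep.trace W (σ * σ)) / 2) ∧
          ∀ᶠ w : HeightOneSpectrum (𝓞 F) in Filter.cofinite, W.IsUnramifiedAt w

/-! ### API -/

section API

variable {F : Type} [Field F] [NumberField F] {ℓ : ℕ} [Fact ℓ.Prime]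

/-- The fact in the form consumed for a FIXED `r` (all quantifiers instantiated): the spin lift
`W` and the multiplier character `ν`. [cite: Patrikis2019, Ch. 2 §2.1] -/
theorem Patrikis2019_exists_spinLift.apply (h : Patrikis2019_exists_spinLift)
    (r : FramedGaloisRep F (PadicAlgCl ℓ) 6)
    (hJ : ∃ J : Matrix (Fin 6) (Fin 6) (PadicAlgCl ℓ), J.IsSymm ∧ IsUnit J ∧
      ∀ σ, ((r σ : GL (Fin 6) (PadicAlgCl ℓ)) : Matrix (Fin 6) (Fin 6) (PadicAlgCl ℓ))ᵀ * J *
        ((r σ : GL (Fin 6) (PadicAlgCl ℓ)) : Matrix (Fin 6) (Fin 6) (PadicAlgCl ℓ)) = J)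
    (hdet : ∀ σ, FramedRep.det r σ = 1)
    (hur : ∀ᶠ v : HeightOneSpectrum (𝓞 F) in Filter.cofinite, r.IsUnramifiedAt v) :
    ∃ (W : FramedGaloisRep F (PadicAlgCl ℓ) 4) (ν : absoluteGaloisGroup F →ₜ* (PadicAlgCl ℓ)ˣ),
      (∀ σ, (ν σ : PadicAlgCl ℓ) * FramedRep.trace r σ =
          (FramedRep.trace W σ ^ 2 - FramedRep.trace W (σ * σ)) / 2) ∧
        ∀ᶠ w : HeightOneSpectrum (𝓞 F) in Filter.cofinite, W.IsUnramifiedAt w :=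
  h F ℓ r hJ hdet hur

/-- **The trace identity is twist-covariant**: if `(W, ν)` witnesses `∧²W ≅ ν ⊗ r` in trace form
and `χ` is a character, then `(W', χ²ν)` witnesses it for any `W'` with `tr W' = χ · tr W`
multiplicatively in the sense `tr W'(σ) = χ(σ) tr W(σ)` for all `σ` (e.g. `W' = W ⊗ χ`): the
bookkeeping `(χ(σ) a)² − χ(σ²) b = χ(σ)² (a² − b)`. [folklore] -/
theorem spinLift_trace_identity_twist {G A : Type*} [Group G] [CommRing A]
    (trW trW' trr : G → A) (ν χ : G →* A)
    (hW' : ∀ σ, trW' σ = χ σ * trW σ)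
    (h : ∀ σ, ν σ * trr σ * 2 = trW σ ^ 2 - trW (σ * σ)) (σ : G) :
    χ σ ^ 2 * ν σ * trr σ * 2 = trW' σ ^ 2 - trW' (σ * σ) := by
  rw [hW', hW', map_mul]
  linear_combination χ σ ^ 2 * h σ

end API

end Literature.NumberTheory.GaloisRepresentations
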